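import Summits.HubbardSuperconductivity.HubbardSuperconductivity.Theorems.JosephsonMirrorJmInterchangeExactResidues

/-!
# Route `JosephsonMirror` — crux `JmCusp` (stmt-HubbardSuperconductivity-2228), line `Sketch`:
# the EXACT single-layer normal form of the bet

Pure-logic consequences, stated on the route declaration `Theses.JosephsonMirror.JmCusp` itself, of the two
landed halves of the single-layer form of the window double (`hypGivesZEPO_of_pigeonhole` with
`windowPigeonhole` / `couplingExpectBound`, and `zepoGivesHyp`, files
`Theorems/JosephsonMirrorJmInterchange{HypGivesZEPO,WindowPigeonhole,CouplingBound,ZepoGivesHyp}`):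

* `josephsonGain_iff_zeroExcessPairOrder` — CLAUSE (i) IS ZERO-EXCESS PAIR ORDER: at every `U > 0`,
  `δ ∈ (0, 1/2)`, "some `a, J₀ > 0` give the uniform linear Josephson gain `a J L² ≤ E_L(0) − E_L(J)` of the
  window double for all `J ∈ (0, J₀]` and all large even `L`" holds iff ZERO-EXCESS `d`-WAVE PAIR ORDER holds
  at `(U, δ)`: some `c > 0` such that for every `ε > 0`, eventually in even `L`, a unit vector `v` of sector
  `N_L` or `N_L − 2` (`S^z = 0`) lies within `εL²` of its sector floor and has `‖Δ_d v‖² ≥ cL⁴`.  Neither the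
  Kronecker double, nor the window, nor `μ_L`, nor `J` occurs on the right.
* `jmCusp_iff_zeroExcessPairOrder_and_simple` — THE BET IN NORMAL FORM: `JmCusp` holds iff some `U > 0`,
  `δ ∈ (0, 1/2)` carry zero-excess `d`-wave pair order AND eventual simplicity of the `(N_L, S^z = 0)` ground
  state (clause (ii) verbatim).
* `jmCusp_of_floorOrder_and_simple` — the sandwich from above: `d`-wave pair order `‖Δ_d g‖² ≥ cL⁴` of ONE
  ground-state sequence of `(N_L, 0)` plus eventual simplicity already give the bet (a ground state has zero
  excess, `zeroExcessPairOrder_of_floorOrder`).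

So the crux has no content beyond the single-layer statement "zero-excess `d`-wave pair order at one coupling and
filling" (the hypothesis of the first residue (R1) of the sibling crux `JmInterchange`,
`jmInterchange_iff_reachesFloor_and_bridges`) and clause (ii); in particular the mirror is eliminable from the bet
exactly as from the interchange.  Nothing here claims either conjunct.

Sources: T. Koma, H. Tasaki, J. Stat. Phys. 76 (1994) 745 (order parameters at vanishing excess energy, trial
states); E. H. Lieb, PRL 62 (1989) 1201 (the `W`-matrix packaging of the double); H. Tasaki, J. Stat. Phys. 174
(2019) 735 §5.  Pure logic over landed theorems; no new definitions (all statements are spelled out on the tree's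
vocabulary).
-/

-- the mandated namespace `Summit.<Summit>.<Problem>.Theorems` repeats `HubbardSuperconductivity`
-- (single-problem summit, D-0017), which the `dupNamespace` linter flags on every declaration
set_option linter.dupNamespace false

namespace Summit.HubbardSuperconductivity.HubbardSuperconductivity.Theorems.JosephsonMirror

open Matrix Literature.MathematicalPhysics.QuantumLattice
open Summit.HubbardSuperconductivity.HubbardSuperconductivity.Theses.JosephsonMirror (JmCusp)

/-- **Clause (i) of the bet is zero-excess pair order (pointwise normal form).**  For `U > 0` and
`δ ∈ (0, 1/2)`: some `a, J₀ > 0` give the uniform linear Josephson gain of the window double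
(`∀ J ∈ (0, J₀], ∃ L₀, ∀ even L ≥ L₀, a J L² ≤ E_L(0) − E_L(J)`, clause (i) of `JmCusp` and the hypothesis of
`JmInterchange`, verbatim) iff zero-excess `d`-wave pair order holds at `(U, δ)`.  `→`: column pigeonhole on the
positive minimiser plus Feynman–Hellmann, `hypGivesZEPO_of_pigeonhole`; `←`: the window trial pair, `zepoGivesHyp`.
Koma–Tasaki, J. Stat. Phys. 76 (1994) 745; Lieb, PRL 62 (1989) 1201. [folklore] -/
theorem josephsonGain_iff_zeroExcessPairOrder (U δ : ℝ) (hU : 0 < U) (hδ : δ ∈ Set.Ioo (0:ℝ) (1 / 2)) :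
    (∃ a J₀ : ℝ, 0 < a ∧ 0 < J₀ ∧
      ∀ J ∈ Set.Ioc (0:ℝ) J₀, ∃ L₀ : ℕ, ∀ (L : ℕ) [NeZero L], Even L → L₀ ≤ L → (let ι : Type := Finset (Literature.MathematicalPhysics.QuantumLattice.Orb (Literature.MathematicalPhysics.QuantumLattice.FermionTorus 2 L)); let N : ℕ := 2 * ⌊(1 - δ) * (L : ℝ) ^ 2 / 2⌋₊; let H : Matrix ι ι ℂ := Literature.MathematicalPhysics.QuantumLattice.hubbardTorus 2 L 1 U; let μ : ℝ := (H.minEnergyOn (Literature.MathematicalPhysics.QuantumLattice.szSector N 0) - H.minEnergyOn (Literature.MathematicalPhysics.QuantumLattice.szSector (N - 2) 0)) / 2; let A : Matrix ι ι ℂ := Literature.MathematicalPhysics.QuantumLattice.hubbardTorusWith 2 L 1 U μ; let D : Matrix ι ι ℂ := ((L : ℂ))⁻¹ • Literature.MathematicalPhysics.QuantumLattice.pairField Literature.MathematicalPhysics.QuantumLattice.dWaveFormFactor L; let Hd : ℝ → Matrix (ι × ι) (ι × ι) ℂ := fun J => Matrix.kroneckerMap (fun a b : ℂ => a * b) A 1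 + Matrix.kroneckerMap (fun a b : ℂ => a * b) 1 (Matrix.transpose A) - (J : ℂ) • (Matrix.kroneckerMap (fun a b : ℂ => a * b) D (Matrix.transpose (Matrix.conjTranspose D)) + Matrix.kroneckerMap (fun a b : ℂ => a * b) (Matrix.conjTranspose D) (Matrix.transpose D)); let good : ι × ι → Prop := fun p => ((p.1.card = N ∧ p.2.card = N) ∨ (p.1.card = N - 2 ∧ p.2.card = N - 2)) ∧ (p.1.filter (fun o => (ofLex o).2 = 0)).card = (p.1.filter (fun o => (ofLex o).2 = 1)).card ∧ (p.2.filter (fun o => (ofLex o).2 = 0)).card = (p.2.filter (fun o => (ofLex o).2 = 1)).card; let S : Submodule ℂ (ι × ι → ℂ) := ⨅ (p : ι × ι) (_ : ¬ good p), LinearMap.ker (LinearMap.proj (R := ℂ) (φ := fun _ : ι × ι => ℂ) p); let E : ℝ → ℝ := fun J => (Hd J).minEnergyOn S; a * J * (L : ℝ) ^ 2 ≤ E 0 - E J)) ↔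
    (∃ c : ℝ, 0 < c ∧ ∀ ε : ℝ, 0 < ε → ∃ L₀ : ℕ, ∀ (L : ℕ) [NeZero L], Even L → L₀ ≤ L →
      ∃ n : ℕ, (n = 2 * ⌊(1 - δ) * (L : ℝ) ^ 2 / 2⌋₊ ∨ n = 2 * ⌊(1 - δ) * (L : ℝ) ^ 2 / 2⌋₊ - 2) ∧
        ∃ v : Fock (Orb (FermionTorus 2 L)), v ∈ szSector n 0 ∧ star v ⬝ᵥ v = 1 ∧
          (star v ⬝ᵥ (hubbardTorus 2 L 1 U *ᵥ v)).re ≤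
              (hubbardTorus 2 L 1 U).minEnergyOn (szSector n 0) + ε * (L : ℝ) ^ 2 ∧
          c * (L : ℝ) ^ 4 ≤
            (star (pairField dWaveFormFactor L *ᵥ v) ⬝ᵥ (pairField dWaveFormFactor L *ᵥ v)).re) := by
  constructor
  · rintro ⟨a, J₀, ha, hJ₀, hG⟩
    exact hypGivesZEPO_of_pigeonhole (fun {ι} _ _ => windowPigeonhole) (fun {ι} _ _ => couplingExpectBound)
      U δ a J₀ hU hδ ha hJ₀ hG
  · intro hZ
    exact zepoGivesHyp U δ hU hδ hZ

/-- **The bet `JmCusp` in single-layer normal form.**  `JmCusp` holds iff some `U > 0`, `δ ∈ (0, 1/2)` carry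
(i') ZERO-EXCESS `d`-WAVE PAIR ORDER — some `c > 0` such that for every `ε > 0`, eventually in even `L`, a unit
vector `v` of sector `N_L` or `N_L − 2` (`S^z = 0`) has energy within `εL²` of its sector floor and
`‖Δ_d v‖² ≥ cL⁴` — AND (ii) eventual simplicity of the `(N_L, S^z = 0)` ground state (clause (ii) of the crux,
verbatim).  Clause (i) ⇔ (i') is `josephsonGain_iff_zeroExcessPairOrder`; clause (ii) is carried.  The Kronecker
double, the window, `μ_L` and `J` are thereby eliminated from the bet.  Koma–Tasaki, J. Stat. Phys. 76 (1994)
745; Lieb, PRL 62 (1989) 1201. [folklore] -/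
theorem jmCusp_iff_zeroExcessPairOrder_and_simple :
    JmCusp ↔
      ∃ U : ℝ, 0 < U ∧ ∃ δ ∈ Set.Ioo (0:ℝ) (1 / 2),
        (∃ c : ℝ, 0 < c ∧ ∀ ε : ℝ, 0 < ε → ∃ L₀ : ℕ, ∀ (L : ℕ) [NeZero L], Even L → L₀ ≤ L →
          ∃ n : ℕ, (n = 2 * ⌊(1 - δ) * (L : ℝ) ^ 2 / 2⌋₊ ∨ n = 2 * ⌊(1 - δ) * (L : ℝ) ^ 2 / 2⌋₊ - 2) ∧
            ∃ v : Fock (Orb (FermionTorus 2 L)), v ∈ szSector n 0 ∧ star v ⬝ᵥ v = 1 ∧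
              (star v ⬝ᵥ (hubbardTorus 2 L 1 U *ᵥ v)).re ≤
                  (hubbardTorus 2 L 1 U).minEnergyOn (szSector n 0) + ε * (L : ℝ) ^ 2 ∧
              c * (L : ℝ) ^ 4 ≤
                (star (pairField dWaveFormFactor L *ᵥ v) ⬝ᵥ (pairField dWaveFormFactor L *ᵥ v)).re) ∧
        (∃ L₀ : ℕ, ∀ (L : ℕ), Even L → L₀ ≤ L → ∀ φ φ' : Fock (Orb (FermionTorus 2 L)),
          IsGroundStateInSector (hubbardTorus 2 L 1 U) (2 * ⌊(1 - δ) * (L : ℝ) ^ 2 / 2⌋₊) 0 φ →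
          IsGroundStateInSector (hubbardTorus 2 L 1 U) (2 * ⌊(1 - δ) * (L : ℝ) ^ 2 / 2⌋₊) 0 φ' →
          ∃ c : ℂ, φ' = c • φ) := by
  constructor
  · intro h
    unfold JmCusp at h
    obtain ⟨U, hU, δ, hδ, a, ha, J₀, hJ₀, hG, hS⟩ := h
    exact ⟨U, hU, δ, hδ, (josephsonGain_iff_zeroExcessPairOrder U δ hU hδ).1 ⟨a, J₀, ha, hJ₀, hG⟩, hS⟩
  · rintro ⟨U, hU, δ, hδ, hZ, hS⟩
    obtain ⟨a, J₀, ha, hJ₀, hG⟩ := (josephsonGain_iff_zeroExcessPairOrder U δ hU hδ).2 hZ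
    unfold JmCusp
    exact ⟨U, hU, δ, hδ, a, ha, J₀, hJ₀, hG, hS⟩

/-- **Floor order of one ground-state sequence plus simplicity gives the bet.**  If at some `U > 0`,
`δ ∈ (0, 1/2)`, eventually in even `L` some unit ground state `g` of `(N_L, S^z = 0)` has `‖Δ_d g‖² ≥ cL⁴`
(finite-volume `d`-wave pair order of ONE ground-state sequence) and the `(N_L, 0)` ground state is eventually
simple, then `JmCusp` holds: a ground state has zero excess (`zeroExcessPairOrder_of_floorOrder`), then the normal
form `jmCusp_iff_zeroExcessPairOrder_and_simple`.  So the bet is no harder than "pair order of one ground-state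
sequence + simplicity" at a clean `d`-wave point.  Koma–Tasaki, J. Stat. Phys. 76 (1994) 745. [folklore] -/
theorem jmCusp_of_floorOrder_and_simple
    (h : ∃ U : ℝ, 0 < U ∧ ∃ δ ∈ Set.Ioo (0:ℝ) (1 / 2),
      (∃ c : ℝ, 0 < c ∧ ∃ L₀ : ℕ, ∀ (L : ℕ) [NeZero L], Even L → L₀ ≤ L →
        ∃ g : Fock (Orb (FermionTorus 2 L)),
          IsGroundStateInSector (hubbardTorus 2 L 1 U) (2 * ⌊(1 - δ) * (L : ℝ) ^ 2 / 2⌋₊) 0 g ∧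
          star g ⬝ᵥ g = 1 ∧
          c * (L : ℝ) ^ 4 ≤
            (star (pairField dWaveFormFactor L *ᵥ g) ⬝ᵥ (pairField dWaveFormFactor L *ᵥ g)).re) ∧
      (∃ L₀ : ℕ, ∀ (L : ℕ), Even L → L₀ ≤ L → ∀ φ φ' : Fock (Orb (FermionTorus 2 L)),
        IsGroundStateInSector (hubbardTorus 2 L 1 U) (2 * ⌊(1 - δ) * (L : ℝ) ^ 2 / 2⌋₊) 0 φ →
        IsGroundStateInSector (hubbardTorus 2 L 1 U) (2 * ⌊(1 - δ) * (L : ℝ) ^ 2 / 2⌋₊) 0 φ' →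
        ∃ c : ℂ, φ' = c • φ)) :
    JmCusp := by
  obtain ⟨U, hU, δ, hδ, hF, hS⟩ := h
  exact jmCusp_iff_zeroExcessPairOrder_and_simple.2 ⟨U, hU, δ, hδ, zeroExcessPairOrder_of_floorOrder U δ hF, hS⟩

end Summit.HubbardSuperconductivity.HubbardSuperconductivity.Theorems.JosephsonMirror
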